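import Literature.NumberTheory.ComplexMultiplication.CMTypeRankIrreducibleSlot
import HarnessLib

/-!
# Transport through a pair-flip slot: an equivariant map on the odd weights of a slot with pair flips into the odd
# weights of a slot of the same size whose pairs the flips preserve is a relabelling of the embeddings

COR-CM (cell `pub-hodgecm2`, binder seat `b16` gen 51, count-neutral claim PAIRFLIP-COMPANION, file F1 — the abstract
`G`-set level; theorems only, no definition, no named fact, no `sorry`).  NEW as stated, hence under `Summits/`.  HONEST
FRAMING: a lemma of finite-dimensional linear algebra about families of CM types; `HC_CM` is neither used nor asserted.

SETTING (the tree's `Literature.NumberTheory.ComplexMultiplication.CMTypeRank*`): a group `G` acting on two finite sets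
`X`, `Y` (Deligne's `Hom(K₀, ℂ)`, `Hom(K₁, ℂ)`), a conjugation `ρ ∈ G` (a fixed-point-free involution on both, commuting
with `G`), the `ρ`-odd weights `Anti(X) ≤ ℚ^X` spanned by the odd vectors `d_x = δ_x − δ_{ρx}` (Shimura's `ζ − ζρ`).
The slot `X` has PAIR FLIPS COMPATIBLE WITH `Y`: for every `x ∈ X` some `φ ∈ G` exchanges `x` and `ρx`, fixes every
other point of `X`, AND maps every `y ∈ Y` to `y` or to `ρy`.  For CM fields: `K₀` is a CM field whose Galois closure
contains the full sign group `(ℤ/2)ⁿ` (a generic CM field) and the sign changes fix the maximal real subfield of `K₁`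
under every embedding — e.g. `K₁⁺ ≅ K₀⁺` (sequel `PairFlipCompanionCMFieldsHodge`).

> **Theorem** (`exists_equivariant_equiv`).  Let `|X| = |Y|` and let `T : ℚ^X → ℚ^Y` be linear, `G`-equivariant on
> `Anti(X)`, with `T(Anti X) ≤ Anti(Y)` and `T` injective on `Anti(X)`.  Then there is a `G`-EQUIVARIANT BIJECTION
> `γ : X ≃ Y` (so `γ(ρx) = ργ(x)`) and positive rationals `c_x` with `T(d_x) = c_x · d_{γ(x)}` for every `x`.

So a common constituent of the odd weights of the two slots is a RELABELLING of the slots (for CM fields: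
`Hom(K₀, ℂ) ≅ Hom(K₁, ℂ)` as `Aut(ℂ)`-sets, i.e. `K₀ ≅ K₁`).

PROOF (supports; no character theory, `G` not assumed finite, no transitivity).  For the flip `φ` at `x` and an odd
`f`: `f − f∘φ = 2f(x)·d_x` (`sub_comp_pairFlip_eq`), so `Tf − (Tf)∘φ = 2f(x)·T(d_x)`; at `y` with `φy = ρy` this reads
`Tf(y) = f(x)·T(d_x)(y)`, at `y` with `φy = y` it reads `f(x)·T(d_x)(y) = 0`.  With `f = d_x`, `d_{x'}` (`x'` off the
pair of `x`): the supports `S_x` of the `T(d_x)` for different pairs are DISJOINT; each is `ρ`-stable and non-empty;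
double counting `T(d_x)(y) ≠ 0` gives `2|X| ≤ Σ_x |S_x| = Σ_y |{x : T(d_x)(y) ≠ 0}| ≤ 2|Y|`, whence `S_x = {y, ρy}`,
`T(d_x) = c·d_y`; orienting `c > 0` pins `y = γ(x)`; equivariance and injectivity of `T` transfer to `γ`.

## References

* [Dodson1984] B. Dodson, *The structure of Galois groups of CM-fields*, Trans. AMS 283 (1984), §1.1 (the sign group
  `(ℤ/2)ⁿ ⋊ H`), §5.1.2 (`ρ`-structures: non-conjugate CM fields with one Galois closure).
* [Gordon1999HodgeAVSurvey] B. B. Gordon, *A survey of the Hodge conjecture for abelian varieties*, §3 Theorem (Imai,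
  Murty) with proof, 7.5–7.7.
* [Shimura1998] G. Shimura, *Abelian Varieties with Complex Multiplication and Modular Functions*, §32.10 (the vectors
  `ζ − ζρ`).
* [Serre1977] J.-P. Serre, *Linear Representations of Finite Groups*, GTM 42, §2.2 (Schur's lemma).
-/

set_option autoImplicit false

open scoped BigOperators

namespace Summit.HodgeConjecture.CorCM

namespace PairFlipTransport

open Literature.NumberTheory.ComplexMultiplication

variable {G : Type*} [Group G] {X Y : Type*} [MulAction G X] [MulAction G Y] {ρ : G}

/-! ### §0 The elementary odd vectors `d_x = δ_x − δ_{ρx}` -/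

/-- `d_x(x) = 1` (`ρ` fixed-point free). [cite: Shimura1998, §32.10 (proof)] -/
theorem single_sub_single_apply_self [DecidableEq X] (hfree : ∀ x : X, ρ • x ≠ x) (x : X) :
    (Pi.single x (1 : ℚ) - Pi.single (ρ • x) 1 : X → ℚ) x = 1 := by
  rw [Pi.sub_apply, Pi.single_eq_same, Pi.single_eq_of_ne (hfree x).symm, sub_zero]

/-- `d_x(ρx) = −1`. [cite: Shimura1998, §32.10 (proof)] -/
theorem single_sub_single_apply_rho [DecidableEq X] (hfree : ∀ x : X, ρ • x ≠ x) (x : X) :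
    (Pi.single x (1 : ℚ) - Pi.single (ρ • x) 1 : X → ℚ) (ρ • x) = -1 := by
  rw [Pi.sub_apply, Pi.single_eq_of_ne (hfree x), Pi.single_eq_same, zero_sub]

/-- `d_x(z) = 0` off the pair `{x, ρx}` (the same fact read at the argument). [cite: Shimura1998, §32.10 (proof)] -/
theorem single_sub_single_apply_eq_zero [DecidableEq X] {x z : X} (h1 : z ≠ x) (h2 : z ≠ ρ • x) :
    (Pi.single x (1 : ℚ) - Pi.single (ρ • x) 1 : X → ℚ) z = 0 := by
  rw [Pi.sub_apply, Pi.single_eq_of_ne h1, Pi.single_eq_of_ne h2, sub_zero]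

/-- `d_{ρx} = −d_x`. [cite: Shimura1998, §32.10 (proof)] -/
theorem single_sub_single_rho [DecidableEq X] (hρ : ∀ x : X, ρ • ρ • x = x) (x : X) :
    (Pi.single (ρ • x) (1 : ℚ) - Pi.single (ρ • ρ • x) 1 : X → ℚ) =
      -(Pi.single x (1 : ℚ) - Pi.single (ρ • x) 1 : X → ℚ) := by
  rw [hρ, neg_sub]

/-- **`c·d_y = c'·d_{y'}` with `c, c' > 0` forces `y = y'` and `c = c'`** (the orientation pins the point).
[cite: Shimura1998, §32.10 (proof)] -/
theorem eq_of_pos_smul_eq [DecidableEq X] (hfree : ∀ y : X, ρ • y ≠ y) {y y' : X} {c c' : ℚ}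
    (hc : 0 < c) (hc' : 0 < c')
    (h : c • (Pi.single y (1 : ℚ) - Pi.single (ρ • y) 1 : X → ℚ) =
      c' • (Pi.single y' (1 : ℚ) - Pi.single (ρ • y') 1 : X → ℚ)) : y = y' ∧ c = c' := by
  have h1 := congrFun h y
  simp only [Pi.smul_apply, smul_eq_mul] at h1
  rw [single_sub_single_apply_self hfree y, mul_one] at h1
  by_cases hyy : y = y'
  · subst hyy
    rw [single_sub_single_apply_self hfree y, mul_one] at h1
    exact ⟨rfl, h1⟩
  · exfalso
    by_cases hyr : y = ρ • y'
    · rw [hyr, single_sub_single_apply_rho hfree y'] at h1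
      linarith
    · rw [single_sub_single_apply_eq_zero hyy hyr, mul_zero] at h1
      linarith

/-! ### §1 The flip identity transported by `T` -/

/-- **The flip identity transported.**  For an odd weight `f` on `X`, a pair flip `φ` of `X` at `x` and a linear `T`
equivariant on the odd weights with odd values: at a point `y ∈ Y` with `φy = ρy` one has `(Tf)(y) = f(x)·T(d_x)(y)`,
and at a point with `φy = y` one has `f(x)·T(d_x)(y) = 0` — from `f − f∘φ = 2f(x)·d_x`.
[cite: Gordon1999HodgeAVSurvey, §3 Theorem (proof)] [cite: Shimura1998, §32.10 (proof)] -/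
theorem apply_eq_mul_apply_of_flip [DecidableEq X] (hρ : ∀ x : X, ρ • ρ • x = x)
    (hcomm : ∀ (g : G) (x : X), g • ρ • x = ρ • g • x) (hfree : ∀ x : X, ρ • x ≠ x)
    (T : (X → ℚ) →ₗ[ℚ] (Y → ℚ))
    (hTeq : ∀ (g : G) (f : X → ℚ), f ∈ antiWeights (E := X) ρ → T (fun x => f (g • x)) = fun y => T f (g • y))
    (hTmem : ∀ f : X → ℚ, f ∈ antiWeights (E := X) ρ → T f ∈ antiWeights (E := Y) ρ)
    {f : X → ℚ} (hf : f ∈ antiWeights (E := X) ρ) {x : X} {φ : G} (hφx : φ • x = ρ • x)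
    (hφ : ∀ x' : X, x' ≠ x → x' ≠ ρ • x → φ • x' = x') (y : Y) :
    (φ • y = ρ • y → T f y = f x * T (Pi.single x (1 : ℚ) - Pi.single (ρ • x) 1) y) ∧
      (φ • y = y → f x * T (Pi.single x (1 : ℚ) - Pi.single (ρ • x) 1) y = 0) := by
  have h1 := sub_comp_pairFlip_eq hρ hcomm hfree hf hφx hφ
  have h2 : T f - T (fun z => f (φ • z)) = (2 * f x) • T (Pi.single x (1 : ℚ) - Pi.single (ρ • x) 1) := by
    rw [← map_smul, ← h1, map_sub]
  rw [hTeq φ f hf] at h2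
  have h3 := congrFun h2 y
  simp only [Pi.sub_apply, Pi.smul_apply, smul_eq_mul] at h3
  have hodd := (mem_antiWeights_iff'.1 (hTmem f hf)) y
  constructor
  · intro hy
    rw [hy, hodd] at h3
    linarith
  · intro hy
    rw [hy] at h3
    linarith

/-- **`T(d_x)` lives on the points flipped by the flip at `x`**: if `T(d_x)(y) ≠ 0` and the flip `φ` at `x` maps `y`
to `y` or `ρy`, then `φy = ρy`. [cite: Gordon1999HodgeAVSurvey, §3 Theorem (proof)] -/
theorem smul_eq_rho_smul_of_apply_ne_zero [DecidableEq X] (hρ : ∀ x : X, ρ • ρ • x = x)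
    (hcomm : ∀ (g : G) (x : X), g • ρ • x = ρ • g • x) (hfree : ∀ x : X, ρ • x ≠ x)
    (T : (X → ℚ) →ₗ[ℚ] (Y → ℚ))
    (hTeq : ∀ (g : G) (f : X → ℚ), f ∈ antiWeights (E := X) ρ → T (fun x => f (g • x)) = fun y => T f (g • y))
    (hTmem : ∀ f : X → ℚ, f ∈ antiWeights (E := X) ρ → T f ∈ antiWeights (E := Y) ρ)
    {x : X} {φ : G} (hφx : φ • x = ρ • x) (hφ : ∀ x' : X, x' ≠ x → x' ≠ ρ • x → φ • x' = x') {y : Y}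
    (hφy : φ • y = y ∨ φ • y = ρ • y) (hy : T (Pi.single x (1 : ℚ) - Pi.single (ρ • x) 1) y ≠ 0) :
    φ • y = ρ • y := by
  rcases hφy with h | h
  · exfalso
    have h1 := (apply_eq_mul_apply_of_flip hρ hcomm hfree T hTeq hTmem
      (single_sub_single_mem_antiWeights hρ x) hφx hφ y).2 h
    rw [single_sub_single_apply_self hfree x, one_mul] at h1
    exact hy h1
  · exact h

/-- **Disjoint supports**: if `T(d_x)(y) ≠ 0` and `T(d_{x'})(y) ≠ 0` then `x' ∈ {x, ρx}` — with the flip `φ` at `x`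
(compatible with `Y`), `y` is flipped by `φ`, and there `T(d_{x'})(y) = d_{x'}(x)·T(d_x)(y) = 0` for `x'` off the
pair of `x`. [cite: Gordon1999HodgeAVSurvey, §3 Theorem (proof)] -/
theorem eq_or_eq_of_apply_ne_zero [DecidableEq X] (hρ : ∀ x : X, ρ • ρ • x = x)
    (hcomm : ∀ (g : G) (x : X), g • ρ • x = ρ • g • x) (hfree : ∀ x : X, ρ • x ≠ x)
    (hflip : ∀ x : X, ∃ φ : G, φ • x = ρ • x ∧ (∀ x' : X, x' ≠ x → x' ≠ ρ • x → φ • x' = x') ∧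
      ∀ y : Y, φ • y = y ∨ φ • y = ρ • y)
    (T : (X → ℚ) →ₗ[ℚ] (Y → ℚ))
    (hTeq : ∀ (g : G) (f : X → ℚ), f ∈ antiWeights (E := X) ρ → T (fun x => f (g • x)) = fun y => T f (g • y))
    (hTmem : ∀ f : X → ℚ, f ∈ antiWeights (E := X) ρ → T f ∈ antiWeights (E := Y) ρ)
    {x x' : X} {y : Y} (hx : T (Pi.single x (1 : ℚ) - Pi.single (ρ • x) 1) y ≠ 0)
    (hx' : T (Pi.single x' (1 : ℚ) - Pi.single (ρ • x') 1) y ≠ 0) : x' = x ∨ x' = ρ • x := by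
  by_contra hne
  push Not at hne
  obtain ⟨φ, hφx, hφ, hφY⟩ := hflip x
  have hfl : φ • y = ρ • y := smul_eq_rho_smul_of_apply_ne_zero hρ hcomm hfree T hTeq hTmem hφx hφ (hφY y) hx
  have h1 := (apply_eq_mul_apply_of_flip hρ hcomm hfree T hTeq hTmem
    (single_sub_single_mem_antiWeights hρ x') hφx hφ y).1 hfl
  rw [single_sub_single_apply_eq_zero hne.1.symm (fun h => hne.2 (by rw [h, hρ])), zero_mul] at h1
  exact hx' h1

/-! ### §2 Double counting: every support is one pair -/

omit [MulAction G Y] in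
/-- `T(d_x) ≠ 0` somewhere (`T` injective on the odd weights, `d_x(x) = 1`). [cite: Serre1977, §2.2] -/
theorem exists_apply_ne_zero [DecidableEq X] (hρ : ∀ x : X, ρ • ρ • x = x) (hfree : ∀ x : X, ρ • x ≠ x)
    (T : (X → ℚ) →ₗ[ℚ] (Y → ℚ)) (hTinj : ∀ f : X → ℚ, f ∈ antiWeights (E := X) ρ → T f = 0 → f = 0) (x : X) :
    ∃ y : Y, T (Pi.single x (1 : ℚ) - Pi.single (ρ • x) 1) y ≠ 0 := by
  by_contra h
  push Not at h
  have h0 : T (Pi.single x (1 : ℚ) - Pi.single (ρ • x) 1) = 0 := funext h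
  have h1 := congrFun (hTinj _ (single_sub_single_mem_antiWeights hρ x) h0) x
  rw [single_sub_single_apply_self hfree x, Pi.zero_apply] at h1
  exact one_ne_zero h1

/-- The fibre `{x : T(d_x)(y) ≠ 0}` over a point `y ∈ Y` has at most two elements (it lies in one pair).
[cite: Gordon1999HodgeAVSurvey, §3 Theorem (proof)] -/
theorem card_filter_apply_ne_zero_le_two [DecidableEq X] [Fintype X] (hρ : ∀ x : X, ρ • ρ • x = x)
    (hcomm : ∀ (g : G) (x : X), g • ρ • x = ρ • g • x) (hfree : ∀ x : X, ρ • x ≠ x)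
    (hflip : ∀ x : X, ∃ φ : G, φ • x = ρ • x ∧ (∀ x' : X, x' ≠ x → x' ≠ ρ • x → φ • x' = x') ∧
      ∀ y : Y, φ • y = y ∨ φ • y = ρ • y)
    (T : (X → ℚ) →ₗ[ℚ] (Y → ℚ))
    (hTeq : ∀ (g : G) (f : X → ℚ), f ∈ antiWeights (E := X) ρ → T (fun x => f (g • x)) = fun y => T f (g • y))
    (hTmem : ∀ f : X → ℚ, f ∈ antiWeights (E := X) ρ → T f ∈ antiWeights (E := Y) ρ) (y : Y) :
    (Finset.univ.filter fun x : X => T (Pi.single x (1 : ℚ) - Pi.single (ρ • x) 1) y ≠ 0).card ≤ 2 := by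
  by_cases h0 : ∃ x₀ : X, T (Pi.single x₀ (1 : ℚ) - Pi.single (ρ • x₀) 1) y ≠ 0
  · obtain ⟨x₀, hx₀⟩ := h0
    calc (Finset.univ.filter fun x : X => T (Pi.single x (1 : ℚ) - Pi.single (ρ • x) 1) y ≠ 0).card
        ≤ ({x₀, ρ • x₀} : Finset X).card := by
          refine Finset.card_le_card fun x hx => ?_
          rw [Finset.mem_filter] at hx
          rcases eq_or_eq_of_apply_ne_zero hρ hcomm hfree hflip T hTeq hTmem hx₀ hx.2 with h | h
          · rw [h]; exact Finset.mem_insert_self _ _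
          · rw [h]; exact Finset.mem_insert_of_mem (Finset.mem_singleton_self _)
      _ ≤ 2 := Finset.card_le_two
  · push Not at h0
    rw [Finset.filter_false_of_mem fun x _ => not_not.2 (h0 x), Finset.card_empty]
    exact Nat.zero_le 2

/-- The support `{y : T(d_x)(y) ≠ 0}` contains a pair `{y₀, ρy₀}`: it is non-empty and `ρ`-stable (`T(d_x)` is odd).
[cite: Shimura1998, §32.10 (proof)] -/
theorem two_le_card_filter_apply_ne_zero [DecidableEq X] [DecidableEq Y] [Fintype Y] (hρ : ∀ x : X, ρ • ρ • x = x)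
    (hfree : ∀ x : X, ρ • x ≠ x) (hfreeY : ∀ y : Y, ρ • y ≠ y) (T : (X → ℚ) →ₗ[ℚ] (Y → ℚ))
    (hTmem : ∀ f : X → ℚ, f ∈ antiWeights (E := X) ρ → T f ∈ antiWeights (E := Y) ρ)
    (hTinj : ∀ f : X → ℚ, f ∈ antiWeights (E := X) ρ → T f = 0 → f = 0) (x : X) :
    2 ≤ (Finset.univ.filter fun y : Y => T (Pi.single x (1 : ℚ) - Pi.single (ρ • x) 1) y ≠ 0).card := by
  obtain ⟨y₀, hy₀⟩ := exists_apply_ne_zero hρ hfree T hTinj x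
  have hodd := (mem_antiWeights_iff'.1 (hTmem _ (single_sub_single_mem_antiWeights hρ x))) y₀
  have hy₁ : T (Pi.single x (1 : ℚ) - Pi.single (ρ • x) 1) (ρ • y₀) ≠ 0 := by
    rw [hodd]; exact neg_ne_zero.2 hy₀
  calc 2 = ({y₀, ρ • y₀} : Finset Y).card := (Finset.card_pair (hfreeY y₀).symm).symm
    _ ≤ _ := by
      refine Finset.card_le_card fun y hy => ?_
      rw [Finset.mem_filter]
      rcases Finset.mem_insert.1 hy with rfl | hy
      · exact ⟨Finset.mem_univ _, hy₀⟩
      · rw [Finset.mem_singleton.1 hy]; exact ⟨Finset.mem_univ _, hy₁⟩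

/-- **Every support is exactly one pair**: with `|X| = |Y|`, `|{y : T(d_x)(y) ≠ 0}| = 2` for every `x` (double
counting the incidence `T(d_x)(y) ≠ 0`: `2|X| ≤ Σ_x |S_x| = Σ_y |fibre_y| ≤ 2|Y|`).
[cite: Gordon1999HodgeAVSurvey, §3 Theorem (proof)] -/
theorem card_support_eq_two [DecidableEq X] [DecidableEq Y] [Fintype X] [Fintype Y] (hρ : ∀ x : X, ρ • ρ • x = x)
    (hcomm : ∀ (g : G) (x : X), g • ρ • x = ρ • g • x) (hfree : ∀ x : X, ρ • x ≠ x)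
    (hfreeY : ∀ y : Y, ρ • y ≠ y)
    (hflip : ∀ x : X, ∃ φ : G, φ • x = ρ • x ∧ (∀ x' : X, x' ≠ x → x' ≠ ρ • x → φ • x' = x') ∧
      ∀ y : Y, φ • y = y ∨ φ • y = ρ • y)
    (T : (X → ℚ) →ₗ[ℚ] (Y → ℚ))
    (hTeq : ∀ (g : G) (f : X → ℚ), f ∈ antiWeights (E := X) ρ → T (fun x => f (g • x)) = fun y => T f (g • y))
    (hTmem : ∀ f : X → ℚ, f ∈ antiWeights (E := X) ρ → T f ∈ antiWeights (E := Y) ρ)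
    (hTinj : ∀ f : X → ℚ, f ∈ antiWeights (E := X) ρ → T f = 0 → f = 0)
    (hcard : Fintype.card X = Fintype.card Y) (x : X) :
    (Finset.univ.filter fun y : Y => T (Pi.single x (1 : ℚ) - Pi.single (ρ • x) 1) y ≠ 0).card = 2 := by
  -- the incidence relation, counted along `X` and along `Y`
  set R : X → Y → Prop := fun x y => T (Pi.single x (1 : ℚ) - Pi.single (ρ • x) 1) y ≠ 0 with hR
  have hrow : ∀ x' : X, 2 ≤ (Finset.univ.filter fun y : Y => R x' y).card := fun x' =>
    two_le_card_filter_apply_ne_zero hρ hfree hfreeY T hTmem hTinj x'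
  have hcol : ∀ y : Y, (Finset.univ.filter fun x' : X => R x' y).card ≤ 2 := fun y =>
    card_filter_apply_ne_zero_le_two hρ hcomm hfree hflip T hTeq hTmem y
  have hswap : ∑ x' : X, (Finset.univ.filter fun y : Y => R x' y).card =
      ∑ y : Y, (Finset.univ.filter fun x' : X => R x' y).card := by
    simp only [Finset.card_filter]
    exact Finset.sum_comm
  have hle : ∑ x' : X, (Finset.univ.filter fun y : Y => R x' y).card ≤ ∑ _x' : X, 2 := by
    rw [hswap]
    calc ∑ y : Y, (Finset.univ.filter fun x' : X => R x' y).card ≤ ∑ _y : Y, 2 :=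
          Finset.sum_le_sum fun y _ => hcol y
      _ = ∑ _x' : X, 2 := by
          simp only [Finset.sum_const, Finset.card_univ, smul_eq_mul, hcard]
  have hge : ∑ _x' : X, (2 : ℕ) ≤ ∑ x' : X, (Finset.univ.filter fun y : Y => R x' y).card :=
    Finset.sum_le_sum fun x' _ => hrow x'
  have heq : ∑ x' : X, (Finset.univ.filter fun y : Y => R x' y).card = ∑ _x' : X, 2 := le_antisymm hle hge
  have hall := (Finset.sum_eq_sum_iff_of_le fun x' _ => hrow x').1 heq.symm
  exact (hall x (Finset.mem_univ x)).symm

/-- **`T(d_x)` is a multiple of an elementary odd vector of `Y`**: `T(d_x) = T(d_x)(y₀) · d_{y₀}` for any `y₀` in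
its support. [cite: Shimura1998, §32.10 (proof)] -/
theorem eq_smul_single_sub [DecidableEq X] [DecidableEq Y] [Fintype X] [Fintype Y] (hρ : ∀ x : X, ρ • ρ • x = x)
    (hcomm : ∀ (g : G) (x : X), g • ρ • x = ρ • g • x) (hfree : ∀ x : X, ρ • x ≠ x)
    (hfreeY : ∀ y : Y, ρ • y ≠ y)
    (hflip : ∀ x : X, ∃ φ : G, φ • x = ρ • x ∧ (∀ x' : X, x' ≠ x → x' ≠ ρ • x → φ • x' = x') ∧
      ∀ y : Y, φ • y = y ∨ φ • y = ρ • y)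
    (T : (X → ℚ) →ₗ[ℚ] (Y → ℚ))
    (hTeq : ∀ (g : G) (f : X → ℚ), f ∈ antiWeights (E := X) ρ → T (fun x => f (g • x)) = fun y => T f (g • y))
    (hTmem : ∀ f : X → ℚ, f ∈ antiWeights (E := X) ρ → T f ∈ antiWeights (E := Y) ρ)
    (hTinj : ∀ f : X → ℚ, f ∈ antiWeights (E := X) ρ → T f = 0 → f = 0)
    (hcard : Fintype.card X = Fintype.card Y) {x : X} {y₀ : Y}
    (hy₀ : T (Pi.single x (1 : ℚ) - Pi.single (ρ • x) 1) y₀ ≠ 0) :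
    T (Pi.single x (1 : ℚ) - Pi.single (ρ • x) 1) =
      T (Pi.single x (1 : ℚ) - Pi.single (ρ • x) 1) y₀ • (Pi.single y₀ (1 : ℚ) - Pi.single (ρ • y₀) 1 : Y → ℚ) := by
  set w : Y → ℚ := T (Pi.single x (1 : ℚ) - Pi.single (ρ • x) 1) with hw
  have hodd : ∀ y, w (ρ • y) = -w y :=
    mem_antiWeights_iff'.1 (hTmem _ (single_sub_single_mem_antiWeights hρ x))
  have hy₁ : w (ρ • y₀) ≠ 0 := by rw [hodd]; exact neg_ne_zero.2 hy₀
  -- the support is `{y₀, ρ y₀}`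
  have hS : (Finset.univ.filter fun y : Y => w y ≠ 0) = {y₀, ρ • y₀} := by
    symm
    refine Finset.eq_of_subset_of_card_le (fun y hy => ?_) ?_
    · rw [Finset.mem_filter]
      rcases Finset.mem_insert.1 hy with rfl | hy
      · exact ⟨Finset.mem_univ _, hy₀⟩
      · rw [Finset.mem_singleton.1 hy]; exact ⟨Finset.mem_univ _, hy₁⟩
    · rw [card_support_eq_two hρ hcomm hfree hfreeY hflip T hTeq hTmem hTinj hcard x,
        Finset.card_pair (hfreeY y₀).symm]
  funext y
  by_cases hy : w y = 0
  · -- off the support both sides vanish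
    have hy' : y ∉ ({y₀, ρ • y₀} : Finset Y) := by
      rw [← hS, Finset.mem_filter]; exact fun h => h.2 hy
    rw [Finset.mem_insert, Finset.mem_singleton, not_or] at hy'
    rw [hy, Pi.smul_apply, smul_eq_mul, single_sub_single_apply_eq_zero hy'.1 hy'.2, mul_zero]
  · have hy' : y ∈ ({y₀, ρ • y₀} : Finset Y) := by
      rw [← hS, Finset.mem_filter]; exact ⟨Finset.mem_univ _, hy⟩
    rw [Pi.smul_apply, smul_eq_mul]
    rcases Finset.mem_insert.1 hy' with rfl | hy'
    · rw [single_sub_single_apply_self hfreeY, mul_one]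
    · rw [Finset.mem_singleton.1 hy', single_sub_single_apply_rho hfreeY y₀, hodd, mul_neg_one]

/-- **Oriented form**: `T(d_x) = c · d_y` for some `y ∈ Y` and some `c > 0`.  [cite: Shimura1998, §32.10 (proof)] -/
theorem exists_pos_smul [DecidableEq X] [DecidableEq Y] [Fintype X] [Fintype Y] (hρ : ∀ x : X, ρ • ρ • x = x)
    (hcomm : ∀ (g : G) (x : X), g • ρ • x = ρ • g • x) (hfree : ∀ x : X, ρ • x ≠ x)
    (hρY : ∀ y : Y, ρ • ρ • y = y) (hfreeY : ∀ y : Y, ρ • y ≠ y)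
    (hflip : ∀ x : X, ∃ φ : G, φ • x = ρ • x ∧ (∀ x' : X, x' ≠ x → x' ≠ ρ • x → φ • x' = x') ∧
      ∀ y : Y, φ • y = y ∨ φ • y = ρ • y)
    (T : (X → ℚ) →ₗ[ℚ] (Y → ℚ))
    (hTeq : ∀ (g : G) (f : X → ℚ), f ∈ antiWeights (E := X) ρ → T (fun x => f (g • x)) = fun y => T f (g • y))
    (hTmem : ∀ f : X → ℚ, f ∈ antiWeights (E := X) ρ → T f ∈ antiWeights (E := Y) ρ)
    (hTinj : ∀ f : X → ℚ, f ∈ antiWeights (E := X) ρ → T f = 0 → f = 0)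
    (hcard : Fintype.card X = Fintype.card Y) (x : X) :
    ∃ (y : Y) (c : ℚ), 0 < c ∧ T (Pi.single x (1 : ℚ) - Pi.single (ρ • x) 1) =
      c • (Pi.single y (1 : ℚ) - Pi.single (ρ • y) 1 : Y → ℚ) := by
  obtain ⟨y₀, hy₀⟩ := exists_apply_ne_zero hρ hfree T hTinj x
  have h1 := eq_smul_single_sub hρ hcomm hfree hfreeY hflip T hTeq hTmem hTinj hcard hy₀
  set c₀ : ℚ := T (Pi.single x (1 : ℚ) - Pi.single (ρ • x) 1) y₀ with hc₀
  rcases lt_trichotomy c₀ 0 with hneg | h0 | hpos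
  · refine ⟨ρ • y₀, -c₀, neg_pos.2 hneg, ?_⟩
    rw [h1, single_sub_single_rho hρY y₀, smul_neg, neg_smul, neg_neg]
  · exact absurd h0 hy₀
  · exact ⟨y₀, c₀, hpos, h1⟩

/-! ### §3 The equivariant bijection -/

/-- **Transport through a pair-flip slot.**  `X` a slot with pair flips compatible with the pairs of `Y`, `|X| = |Y|`,
`T : ℚ^X → ℚ^Y` linear, `G`-equivariant on `Anti(X)`, with odd values and injective on `Anti(X)`.  Then there is a
`G`-equivariant bijection `γ : X ≃ Y` (in particular `γ(ρx) = ργ(x)`) and positive `c_x` with `T(d_x) = c_x · d_{γx}`: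
a common constituent of the odd weights of the two slots is a RELABELLING of the slots.  (For CM fields, sequel
`PairFlipCompanionCMFieldsHodge`: `Hom(K₀, ℂ) ≅ Hom(K₁, ℂ)` as `Aut(ℂ)`-sets, so `K₀ ≅ K₁`.)
[cite: Dodson1984, §5.1.2] [cite: Gordon1999HodgeAVSurvey, §3 Theorem (proof) and 7.5–7.7] [cite: Serre1977, §2.2] -/
theorem exists_equivariant_equiv [DecidableEq X] [DecidableEq Y] [Fintype X] [Fintype Y] (hρ : ∀ x : X, ρ • ρ • x = x)
    (hcomm : ∀ (g : G) (x : X), g • ρ • x = ρ • g • x) (hfree : ∀ x : X, ρ • x ≠ x)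
    (hρY : ∀ y : Y, ρ • ρ • y = y) (hcommY : ∀ (g : G) (y : Y), g • ρ • y = ρ • g • y)
    (hfreeY : ∀ y : Y, ρ • y ≠ y)
    (hflip : ∀ x : X, ∃ φ : G, φ • x = ρ • x ∧ (∀ x' : X, x' ≠ x → x' ≠ ρ • x → φ • x' = x') ∧
      ∀ y : Y, φ • y = y ∨ φ • y = ρ • y)
    (T : (X → ℚ) →ₗ[ℚ] (Y → ℚ))
    (hTeq : ∀ (g : G) (f : X → ℚ), f ∈ antiWeights (E := X) ρ → T (fun x => f (g • x)) = fun y => T f (g • y))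
    (hTmem : ∀ f : X → ℚ, f ∈ antiWeights (E := X) ρ → T f ∈ antiWeights (E := Y) ρ)
    (hTinj : ∀ f : X → ℚ, f ∈ antiWeights (E := X) ρ → T f = 0 → f = 0)
    (hcard : Fintype.card X = Fintype.card Y) :
    ∃ γ : X ≃ Y, (∀ (g : G) (x : X), γ (g • x) = g • γ x) ∧
      ∀ x : X, ∃ c : ℚ, 0 < c ∧ T (Pi.single x (1 : ℚ) - Pi.single (ρ • x) 1) =
        c • (Pi.single (γ x) (1 : ℚ) - Pi.single (ρ • γ x) 1 : Y → ℚ) := by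
  have hex := exists_pos_smul hρ hcomm hfree hρY hfreeY hflip T hTeq hTmem hTinj hcard
  choose γ c hc hγ using hex
  -- uniqueness of the oriented representation
  have huniq : ∀ (x : X) (y : Y) (c' : ℚ), 0 < c' →
      T (Pi.single x (1 : ℚ) - Pi.single (ρ • x) 1) = c' • (Pi.single y (1 : ℚ) - Pi.single (ρ • y) 1 : Y → ℚ) →
      γ x = y ∧ c x = c' := fun x y c' hc' h =>
    eq_of_pos_smul_eq hfreeY (hc x) hc' ((hγ x).symm.trans h)
  -- equivariance
  have hequiv : ∀ (g : G) (x : X), γ (g • x) = g • γ x := by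
    intro g x
    -- `T(d_{gx} ∘ g) = T(d_{gx}) ∘ g`, i.e. `T(d_x) = c_{gx} · d_{g⁻¹ γ(gx)}`
    have h1 := hTeq g _ (single_sub_single_mem_antiWeights hρ (g • x))
    rw [single_sub_single_comp_smul hcomm (g • x) g, inv_smul_smul, hγ (g • x)] at h1
    have h2 : (fun y => (c (g • x) • (Pi.single (γ (g • x)) (1 : ℚ) - Pi.single (ρ • γ (g • x)) 1 : Y → ℚ))
        (g • y)) = c (g • x) • (Pi.single (g⁻¹ • γ (g • x)) (1 : ℚ) - Pi.single (ρ • g⁻¹ • γ (g • x)) 1 : Y → ℚ) := by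
      rw [← single_sub_single_comp_smul hcommY (γ (g • x)) g]
      rfl
    rw [h2] at h1
    have h3 := (huniq x (g⁻¹ • γ (g • x)) (c (g • x)) (hc (g • x)) h1).1
    rw [h3, smul_inv_smul]
  -- injectivity
  have hinj : Function.Injective γ := by
    intro x x' hxx
    have hx : T (Pi.single x (1 : ℚ) - Pi.single (ρ • x) 1) (γ x) ≠ 0 := by
      rw [hγ x, Pi.smul_apply, smul_eq_mul, single_sub_single_apply_self hfreeY, mul_one]
      exact (hc x).ne'
    have hx' : T (Pi.single x' (1 : ℚ) - Pi.single (ρ • x') 1) (γ x) ≠ 0 := by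
      rw [hxx, hγ x', Pi.smul_apply, smul_eq_mul, single_sub_single_apply_self hfreeY, mul_one]
      exact (hc x').ne'
    rcases eq_or_eq_of_apply_ne_zero hρ hcomm hfree hflip T hTeq hTmem hx hx' with h | h
    · exact h.symm
    · exfalso
      -- `T(d_{ρx}) = −c_x d_{γx}` cannot be `c_{x'} d_{γx'}` with `γ x' = γ x`
      have h1 : T (Pi.single x' (1 : ℚ) - Pi.single (ρ • x') 1) =
          -(c x • (Pi.single (γ x) (1 : ℚ) - Pi.single (ρ • γ x) 1 : Y → ℚ)) := by
        rw [h, single_sub_single_rho hρ x, map_neg, hγ x]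
      have h2 := congrFun ((hγ x').symm.trans h1) (γ x')
      simp only [Pi.smul_apply, Pi.neg_apply, smul_eq_mul] at h2
      rw [single_sub_single_apply_self hfreeY, hxx, single_sub_single_apply_self hfreeY] at h2
      have := hc x
      have := hc x'
      linarith
  have hbij : Function.Bijective γ := (Fintype.bijective_iff_injective_and_card γ).2 ⟨hinj, hcard⟩
  refine ⟨Equiv.ofBijective γ hbij, fun g x => hequiv g x, fun x => ⟨c x, hc x, ?_⟩⟩
  exact hγ x

end PairFlipTransport

end Summit.HodgeConjecture.CorCM
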